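import Literature.AlgebraicGeometry.HodgeTheory.WeilSurfaceSquareModel
import Literature.AlgebraicGeometry.Motives.DworkFamily
import Literature.AlgebraicGeometry.Motives.AbelianVarietyRigidity
import Literature.NumberTheory.EllipticCurves.LatticeJInvariant
import HarnessLib

/-!
# The Eisenstein curve `E_ω = ℂ/(ℤ + ωℤ)` as a complex abelian variety with `√-3 ∈ End(E_ω)`

Layer `Literature/AlgebraicGeometry/HodgeTheory`, companion of `WeilSurfaceSquareModel` (the
Weierstrass cubic `E_τ` of ANY lattice `ℤ + τℤ` as an `AbelianVariety ℂ`, `WeilSquare.curveAV τ`,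
with its uniformisation `WeilSquare.uE τ : ℂ → E_τ(ℂ)`, `z ↦ [℘(z), ℘'(z)/2, 1]`, a homomorphism).
For the hexagonal lattice `Λ = ℤ + ωℤ`, `ω = e^{2πi/3} = (-1 + i√3)/2` (so `ωΛ = Λ`), this file
constructs the complex multiplication ALGEBRAICALLY:

* `WeilSquare.omega` and its arithmetic (`ω² + ω + 1 = 0`, `ω³ = 1`, `(2ω + 1)² = -3`);
* `g₂(Λ) = 0` (`WeilSquare.g₂_eisPair`: `g₂(Λ) = g₂(ωΛ) = ω⁻⁴ g₂(Λ)`, Cox §10.C; Silverman AEC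
  Ex. 6.8 (b)), so `E_ω : y² = x³ - g₃/4` and the Weierstrass form `Y²Z - X³ - a₆Z³` is INVARIANT
  under the diagonal substitution `(X, Y, Z) ↦ (ζX, Y, Z)`, `ζ³ = 1` (`aeval_diagSubst_polynomial`);
* `WeilSquare.rotOver` — the restriction to `E_ω ⊂ ℙ²` of the projective linear automorphism
  `[X : Y : Z] ↦ [ωX : Y : Z]` (the tree's `SmoothHypersurface.substLift`, Hartshorne II Ex. 3.11 (d)),
  acting on points by `[x : y : z] ↦ [ωx : y : z]` (`map_rotOver_schemePoint`) and hence THROUGH THE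
  UNIFORMISATION BY `z ↦ ωz` (`map_rotOver_uE`: `℘(ωz) = ω℘(z)`, `℘'(ωz) = ℘'(z)` by homogeneity,
  Silverman AEC VI.3 / the tree's `weierstrassP_mulLeft`); it fixes `O = [0 : 1 : 0]`, hence is a
  HOMOMORPHISM of abelian varieties by rigidity (`WeilSquare.rot`; Mumford §4 Cor. 1, the tree's
  `isMonHom_of_one_comp`) — Silverman AEC III.10.1: `[ω](x, y) = (ωx, y)` on `y² = x³ + B`;
* `WeilSquare.rho = [ω] + [ω] + 1 = [2ω + 1] = [√-3]`, acting through the uniformisation by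
  `z ↦ (2ω + 1)z = i√3·z` (`comp_rho_uE`), with **`ρ ∘ ρ = [-3]`** (`WeilSquare.rho_comp_rho`; checked on
  `ℂ`-points, which separate homomorphisms, Mumford §4): `E_ω` has complex multiplication by
  `ℤ[√-3] ⊂ ℤ[ω]` (Cox, *Primes of the form x² + ny²*, §10.C and Prop. 14.9, direction
  `End(Λ) → End(E)` for `α = ω`).

Everything is proved; no named fact and no new carrier is introduced (D-0026). Consumer: the
counterexample `(A, φ) = (E_ω-powers, (ρ, ρ, -ρ, ρ)-type)` showing that the single-test rendering
of "Weil type" in `Motives.exists_cmWeilSurface_aimedSplitProduct` collides at `d = 3`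
(`Motives/AimedSplitProduct`, `## Misstatement`).

## References

* [SilvermanAEC2009] J. H. Silverman, *The Arithmetic of Elliptic Curves*, 2nd ed. (2009), III.10.1,
  VI.3 (homogeneity of `℘`), VI.4.1, Ex. 6.8.
* [Cox2013] D. A. Cox, *Primes of the form x² + ny²*, 2nd ed. (2013), §10.C, Prop. 14.9.
* [MumfordAV1970] D. Mumford, *Abelian Varieties* (1970), §4 (rigidity; Cor. 1).
* [Hartshorne1977] R. Hartshorne, *Algebraic Geometry* (1977), II Ex. 2.14, II Ex. 3.11 (d),
  II Example 7.1.1.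
-/

noncomputable section

open CategoryTheory MonoidalCategory CartesianMonoidalCategory AlgebraicGeometry Complex MvPolynomial
open scoped MonObj PeriodPair
open Literature.AlgebraicGeometry.Motives Literature.AlgebraicGeometry.Motives.AlgPoints
open Literature.NumberTheory.EllipticCurves

namespace Literature.AlgebraicGeometry.HodgeTheory

namespace WeilSquare

/-! ### The primitive cube root of unity `ω = (-1 + i√3)/2` -/

/-- `ω = e^{2πi/3} = -1/2 + (√3/2) i`. [folklore] -/
def omega : ℂ := -1 / 2 + (Real.sqrt 3 / 2 : ℝ) * I

/-- `(√3)² = 3` in `ℂ`. [folklore] -/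
theorem sqrt_three_sq : ((Real.sqrt 3 : ℝ) : ℂ) ^ 2 = 3 := by
  rw [← Complex.ofReal_pow, Real.sq_sqrt (by norm_num : (0 : ℝ) ≤ 3)]; norm_num

/-- `Im ω = √3/2`. [folklore] -/
theorem omega_im : omega.im = Real.sqrt 3 / 2 := by
  simp [omega]

/-- `Im ω ≠ 0`. [folklore] -/
theorem omega_im_ne_zero : omega.im ≠ 0 := by
  rw [omega_im]
  positivity

/-- `ω² + ω + 1 = 0`. [folklore] -/
theorem omega_sq_add_omega_add_one : omega ^ 2 + omega + 1 = 0 := by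
  have h3 := sqrt_three_sq
  have hI : I ^ 2 = -1 := Complex.I_sq
  have hω : omega = -1 / 2 + ((Real.sqrt 3 : ℝ) : ℂ) / 2 * I := by
    simp only [omega, Complex.ofReal_div, Complex.ofReal_ofNat]
  rw [hω]
  linear_combination (((Real.sqrt 3 : ℝ) : ℂ) ^ 2 / 4) * hI - (1 / 4 : ℂ) * h3

/-- `ω² = -1 - ω`. [folklore] -/
theorem omega_sq : omega ^ 2 = -1 - omega := by
  linear_combination omega_sq_add_omega_add_one

/-- `ω³ = 1`. [folklore] -/
theorem omega_pow_three : omega ^ 3 = 1 := by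
  linear_combination (omega - 1) * omega_sq_add_omega_add_one

/-- `ω ≠ 0`. [folklore] -/
theorem omega_ne_zero : omega ≠ 0 := fun h => by
  have := omega_pow_three
  rw [h, zero_pow three_ne_zero] at this
  exact zero_ne_one this

/-- `ω ≠ 1`. [folklore] -/
theorem omega_ne_one : omega ≠ 1 := fun h => by
  have := omega_im
  rw [h, Complex.one_im] at this
  have h3 : (0 : ℝ) < Real.sqrt 3 / 2 := by positivity
  linarith

/-- `ω⁴ = ω`. [folklore] -/
theorem omega_pow_four : omega ^ 4 = omega := by
  rw [pow_succ, omega_pow_three, one_mul]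

/-- `(ω²)⁻¹ = ω`. [folklore] -/
theorem omega_sq_inv : (omega ^ 2)⁻¹ = omega :=
  inv_eq_of_mul_eq_one_right (by rw [← pow_succ, omega_pow_three])

/-- `ω⁻¹ = ω²`. [folklore] -/
theorem omega_inv : omega⁻¹ = omega ^ 2 :=
  inv_eq_of_mul_eq_one_right (by rw [← pow_succ', omega_pow_three])

/-- `(2ω + 1)² = -3`: `2ω + 1 = i√3` is a square root of `-3` in `ℤ[ω]`. [folklore] -/
theorem two_mul_omega_add_one_sq : (2 * omega + 1) ^ 2 = -3 := by
  linear_combination (4 : ℂ) * omega_sq_add_omega_add_one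

/-! ### The hexagonal lattice `Λ = ℤ + ωℤ` is stable under `ω` -/

/-- The period pair `(1, ω)` of the hexagonal lattice `ℤ + ωℤ`. [folklore] -/
abbrev eisPair : PeriodPair := periodPair omega omega_im_ne_zero

/-- `ωx ∈ ℤ + ωℤ ↔ x ∈ ℤ + ωℤ` (`ω·(m + nω) = -n + (m - n)ω`, `ω⁻¹ = ω²`). [folklore] -/
theorem omega_mul_mem_lattice_iff (x : ℂ) : omega * x ∈ eisPair.lattice ↔ x ∈ eisPair.lattice := by
  have step : ∀ y, y ∈ eisPair.lattice → omega * y ∈ eisPair.lattice := by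
    intro y hy
    rw [mem_lattice_periodPair_iff] at hy ⊢
    obtain ⟨m, n, rfl⟩ := hy
    refine ⟨-n, m - n, ?_⟩
    push_cast
    linear_combination (-(n : ℂ)) * omega_sq
  refine ⟨fun hx => ?_, step x⟩
  have h2 := step _ (step _ hx)
  have : omega * (omega * (omega * x)) = x := by
    rw [← mul_assoc, ← mul_assoc, show omega * omega * omega = omega ^ 3 by ring, omega_pow_three,
      one_mul]
  rwa [this] at h2

/-- `ωΛ = Λ` as lattices of period pairs. [folklore] -/
theorem mulLeft_omega_lattice_eq : (eisPair.mulLeft omega omega_ne_zero).lattice = eisPair.lattice :=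
  PeriodPair.mulLeft_lattice_eq_of_mul_mem_lattice_iff omega_ne_zero omega_mul_mem_lattice_iff

/-- **`g₂(ℤ + ωℤ) = 0`**: `g₂(Λ) = g₂(ωΛ) = ω⁻⁴ g₂(Λ) = ω⁻¹ g₂(Λ)` and `ω ≠ 1` (Cox §10.C; Silverman
AEC Ex. 6.8 (b): `j(ω) = 0`). [cite: Cox2013, §10.C] -/
theorem g₂_eisPair : eisPair.g₂ = 0 := by
  have h := PeriodPair.g₂_eq_of_mul_mem_lattice_iff (L := eisPair) omega_ne_zero omega_mul_mem_lattice_iff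
  rw [omega_pow_four, omega_inv] at h
  have h' : (1 - omega ^ 2) * eisPair.g₂ = 0 := by linear_combination h
  rcases mul_eq_zero.mp h' with h0 | h0
  · exfalso
    have hsq : omega ^ 2 = 1 := by linear_combination -h0
    have h3 := omega_pow_three
    rw [pow_succ, hsq, one_mul] at h3
    exact omega_ne_one h3
  · exact h0

/-- Hence `a₄(E_ω) = -g₂/4 = 0`: `E_ω : y² = x³ - g₃/4`. [cite: Cox2013, §10.C] -/
theorem curve_a₄_eisPair : eisPair.curve.a₄ = 0 := by
  rw [PeriodPair.curve_a₄, g₂_eisPair, neg_zero, zero_div]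

/-! ### Homogeneity of `℘`: `℘(ωz) = ω℘(z)`, `℘'(ωz) = ℘'(z)` -/

/-- `℘_Λ(ωz) = ω ℘_Λ(z)` for the hexagonal lattice (`℘_{ωΛ}(ωz) = ω⁻²℘_Λ(z)` and `ωΛ = Λ`).
[cite: SilvermanAEC2009, VI.3] -/
theorem weierstrassP_omega_mul (z : ℂ) : ℘[eisPair] (omega * z) = omega * ℘[eisPair] z := by
  have h := PeriodPair.weierstrassP_mulLeft omega omega_ne_zero eisPair z
  rw [PeriodPair.weierstrassP_eq_of_lattice_eq mulLeft_omega_lattice_eq] at h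
  rw [h, omega_sq_inv]

/-- `℘'_Λ(ωz) = ℘'_Λ(z)` for the hexagonal lattice (`℘'_{ωΛ}(ωz) = ω⁻³℘'_Λ(z)`, `ω³ = 1`).
[cite: SilvermanAEC2009, VI.3] -/
theorem derivWeierstrassP_omega_mul (z : ℂ) : ℘'[eisPair] (omega * z) = ℘'[eisPair] z := by
  have h := PeriodPair.derivWeierstrassP_mulLeft omega omega_ne_zero eisPair z
  rw [PeriodPair.derivWeierstrassP_eq_of_lattice_eq mulLeft_omega_lattice_eq] at h
  rw [h, omega_pow_three, inv_one, one_mul]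

/-! ### The diagonal substitution `(X, Y, Z) ↦ (ζX, Y, Z)` fixes the Weierstrass form of `E_ω` -/

/-- The scaling vector `(ζ, 1, 1)`. [folklore] -/
def rotVec (ζ : ℂ) : Fin 3 → ℂ := ![ζ, 1, 1]

/-- `(ζ, 1, 1)₀ = ζ`. [folklore] -/
@[simp] theorem rotVec_zero (ζ : ℂ) : rotVec ζ 0 = ζ := rfl

/-- `(ζ, 1, 1)₁ = 1`. [folklore] -/
@[simp] theorem rotVec_one (ζ : ℂ) : rotVec ζ 1 = 1 := rfl

/-- `(ζ, 1, 1)₂ = 1`. [folklore] -/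
@[simp] theorem rotVec_two (ζ : ℂ) : rotVec ζ 2 = 1 := rfl

/-- The entries of `(ζ, 1, 1)` are non-zero for `ζ ≠ 0`. [folklore] -/
theorem rotVec_ne_zero {ζ : ℂ} (hζ : ζ ≠ 0) (j : Fin 3) : rotVec ζ j ≠ 0 := by
  fin_cases j
  · exact hζ
  · exact one_ne_zero
  · exact one_ne_zero

/-- Scaling a vector by `(ζ, 1, 1)`: `(x, y, z) ↦ (ζx, y, z)`. [folklore] -/
theorem rotVec_mul_apply (ζ : ℂ) (v : Fin 3 → ℂ) :
    (fun j => algebraMap ℂ ℂ (rotVec ζ j) * v j) = ![ζ * v 0, v 1, v 2] := by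
  funext j
  fin_cases j <;> simp

/-- **A Weierstrass form with `a₁ = a₂ = a₄ = 0` is invariant under `X ↦ ζX` for `ζ³ = 1`**:
`Y²Z + a₃YZ² - (ζ³X³ + a₆Z³) = Y²Z + a₃YZ² - (X³ + a₆Z³)`. [folklore] -/
theorem aeval_diagSubst_polynomial_of {W : WeierstrassCurve ℂ} (h₁ : W.a₁ = 0) (h₂ : W.a₂ = 0)
    (h₄ : W.a₄ = 0) {ζ : ℂ} (hζ : ζ ^ 3 = 1) :
    aeval (ProjectiveSpace.diagSubst (rotVec ζ)) W.toProjective.polynomial = W.toProjective.polynomial := by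
  have hX : ∀ j : Fin 3, aeval (ProjectiveSpace.diagSubst (rotVec ζ)) (X j : MvPolynomial (Fin 3) ℂ) =
      C (rotVec ζ j) * X j := fun j => by
    rw [aeval_X, ProjectiveSpace.diagSubst_apply]
  have ha₁ : W.toProjective.a₁ = 0 := h₁
  have ha₂ : W.toProjective.a₂ = 0 := h₂
  have ha₄ : W.toProjective.a₄ = 0 := h₄
  simp only [WeierstrassCurve.Projective.polynomial, map_sub, map_add, map_mul, map_pow, aeval_C, hX,
    MvPolynomial.algebraMap_eq, rotVec_zero, rotVec_one, rotVec_two, C_1, one_mul, ha₁, ha₂, ha₄, C_0,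
    zero_mul, add_zero]
  have hC : (C ζ : MvPolynomial (Fin 3) ℂ) ^ 3 = 1 := by rw [← C_pow, hζ, C_1]
  linear_combination (-(X 0 : MvPolynomial (Fin 3) ℂ) ^ 3) * hC

/-- The Weierstrass form of `E_ω` is invariant under `(X, Y, Z) ↦ (ζX, Y, Z)`, `ζ³ = 1`. [folklore] -/
theorem aeval_diagSubst_polynomial {ζ : ℂ} (hζ : ζ ^ 3 = 1) :
    aeval (ProjectiveSpace.diagSubst (rotVec ζ)) eisPair.curve.toProjective.polynomial =
      eisPair.curve.toProjective.polynomial :=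
  aeval_diagSubst_polynomial_of rfl rfl curve_a₄_eisPair hζ

/-! ### The rotation `[X : Y : Z] ↦ [ωX : Y : Z]` of `E_ω` -/

/-- **The rotation `[X : Y : Z] ↦ [ωX : Y : Z]` of `E_ω` as a `ℂ`-morphism of schemes**: the
restriction to the cubic `E_ω ⊂ ℙ²_ℂ` of the diagonal projective transformation `diag(ω, 1, 1)`
(which fixes its equation). [cite: Hartshorne1977, II Ex. 3.11 (d) and Example 7.1.1] -/
def rotOver : eisPair.curve.scheme ⟶ eisPair.curve.scheme :=
  SmoothHypersurface.substLift (n := 1) eisPair.curve.toProjective.polynomial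
    (ProjectiveSpace.diagSubst (rotVec omega)) (ProjectiveSpace.isHomogeneous_diagSubst _)
    (ProjectiveSpace.diagSubst fun j => (rotVec omega j)⁻¹) (ProjectiveSpace.isHomogeneous_diagSubst _)
    (ProjectiveSpace.aeval_diagSubst_diagSubst_inv (rotVec_ne_zero omega_ne_zero))
    (aeval_diagSubst_polynomial omega_pow_three)

/-- `rotOver` is the restriction of `diagMap (ω, 1, 1)`: `rotOver ≫ ι = ι ≫ diagMap`. [folklore] -/
theorem rotOver_comp_schemeι :
    rotOver ≫ eisPair.curve.schemeι =
      eisPair.curve.schemeι ≫ ProjectiveSpace.diagMap (rotVec omega) (rotVec_ne_zero omega_ne_zero) :=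
  SmoothHypersurface.substLift_comp_hypersurfaceι _ _ _ _ _ _ _

/-- Scaling the `X`-coordinate of a solution of the Weierstrass equation of `E_ω` by `ζ`, `ζ³ = 1`,
gives a solution. [folklore] -/
theorem equation_rotVec_mul {ζ : ℂ} (hζ : ζ ^ 3 = 1) {v : Fin 3 → ℂ}
    (hv : (eisPair.curve.baseChange ℂ).toProjective.Equation v) :
    (eisPair.curve.baseChange ℂ).toProjective.Equation fun j => algebraMap ℂ ℂ (rotVec ζ j) * v j := by
  rw [← WeierstrassCurve.aeval_toProjective_polynomial_eq_zero_iff] at hv ⊢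
  rw [← ProjectiveSpace.substVec_diagSubst]
  change aeval (fun j => aeval v (ProjectiveSpace.diagSubst (rotVec ζ) j)) _ = 0
  rw [← ProjectiveSpace.aeval_substGraded _ (ProjectiveSpace.isHomogeneous_diagSubst _),
    ProjectiveSpace.substGraded_apply, aeval_diagSubst_polynomial hζ, hv]

/-- A scaled non-zero vector is non-zero (`ζ ≠ 0`). [folklore] -/
theorem rotVec_mul_ne_zero {ζ : ℂ} (hζ : ζ ≠ 0) {v : Fin 3 → ℂ} (hv : v ≠ 0) :
    (fun j => algebraMap ℂ ℂ (rotVec ζ j) * v j) ≠ 0 := by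
  intro h
  apply hv
  funext j
  have hj := congrFun h j
  simp only [Pi.zero_apply, Algebra.algebraMap_self, RingHom.id_apply, mul_eq_zero] at hj
  exact hj.resolve_left (rotVec_ne_zero hζ j)

/-- **`rotOver` on points: `[x : y : z] ↦ [ωx : y : z]`.** [cite: Hartshorne1977, II Ex. 2.14] -/
theorem map_rotOver_schemePoint (v : Fin 3 → ℂ) (hv : v ≠ 0)
    (hEq : (eisPair.curve.baseChange ℂ).toProjective.Equation v) :
    AlgPoints.map rotOver (eisPair.curve.schemePoint v hv hEq) =
      eisPair.curve.schemePoint (fun j => algebraMap ℂ ℂ (rotVec omega j) * v j)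
        (rotVec_mul_ne_zero omega_ne_zero hv) (equation_rotVec_mul omega_pow_three hEq) := by
  apply AlgPoints.map_injective_of_mono eisPair.curve.schemeι
  rw [← AlgPoints.map_comp_apply, rotOver_comp_schemeι, AlgPoints.map_comp_apply,
    WeierstrassCurve.map_schemeι_schemePoint, WeierstrassCurve.map_schemeι_schemePoint, AlgPoints.map_apply,
    ProjectiveSpace.pointOfVec_comp_diagMap]

/-- **`rotOver` through the uniformisation: `[ω]·u(z) = u(ωz)`** (`℘(ωz) = ω℘(z)`, `℘'(ωz) = ℘'(z)`,
and `O ↦ O`). [cite: SilvermanAEC2009, VI.3 and III.10.1] -/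
theorem map_rotOver_upoint (z : ℂ) :
    AlgPoints.map rotOver (eisPair.upoint z) = eisPair.upoint (omega * z) := by
  by_cases hz : z ∈ eisPair.lattice
  · have hz' : omega * z ∈ eisPair.lattice := (omega_mul_mem_lattice_iff z).2 hz
    rw [PeriodPair.upoint_of_mem hz, PeriodPair.upoint_of_mem hz', map_rotOver_schemePoint]
    congr 1
    rw [rotVec_mul_apply]
    simp
  · have hz' : omega * z ∉ eisPair.lattice := fun h => hz ((omega_mul_mem_lattice_iff z).1 h)
    obtain ⟨hF, hzeq⟩ := PeriodPair.upoint_of_notMem hz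
    obtain ⟨hF', hz'eq⟩ := PeriodPair.upoint_of_notMem hz'
    rw [hzeq, hz'eq, map_rotOver_schemePoint]
    congr 1
    rw [rotVec_mul_apply, weierstrassP_omega_mul, derivWeierstrassP_omega_mul]
    simp

/-- The same on the complex points of the abelian variety `E_ω` (`uE = upoint`). [folklore] -/
theorem map_rotOver_uE (z : ℂ) :
    AlgPoints.map rotOver (uE omega omega_im_ne_zero z) = uE omega omega_im_ne_zero (omega * z) :=
  map_rotOver_upoint z

/-- A section of `toUnit (Spec ℂ) : specOver ℂ ℂ ⟶ 𝟙_` (both are `Spec ℂ` over `Spec ℂ`). [folklore] -/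
def unitSection : 𝟙_ (SchemeOver ℂ) ⟶ specOver ℂ ℂ :=
  Over.homMk (𝟙_ (SchemeOver ℂ)).hom <| by
    change (𝟙_ (SchemeOver ℂ)).hom ≫ Spec.map (CommRingCat.ofHom (algebraMap ℂ ℂ)) = (𝟙_ (SchemeOver ℂ)).hom
    rw [Algebra.algebraMap_self, CommRingCat.ofHom_id, Spec.map_id, Category.comp_id]

/-- `toUnit (Spec ℂ)` is a (split) epimorphism. [folklore] -/
theorem epi_toUnit_specOver : Epi (toUnit (specOver ℂ ℂ) : specOver ℂ ℂ ⟶ 𝟙_ (SchemeOver ℂ)) := by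
  have ht : unitSection ≫ toUnit (specOver ℂ ℂ) = 𝟙 _ := toUnit_unique _ _
  exact ⟨fun f g h => by
    simpa [← Category.assoc, ht] using congrArg (fun k => unitSection ≫ k) h⟩

/-- **`rotOver` fixes the origin `O = [0 : 1 : 0]`** (scheme-level form). [cite: SilvermanAEC2009, III.10.1] -/
theorem oneHom_comp_rotOver : eisPair.curve.oneHom ≫ rotOver = eisPair.curve.oneHom := by
  haveI := epi_toUnit_specOver
  rw [← cancel_epi (toUnit (specOver ℂ ℂ)), ← Category.assoc, WeierstrassCurve.toUnit_comp_oneHom]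
  change AlgPoints.map rotOver _ = _
  rw [map_rotOver_schemePoint]
  congr 1
  rw [rotVec_mul_apply]
  simp

/-- The unit of the group scheme `E_ω` is the section `O = [0 : 1 : 0]` (`rfl`). [folklore] -/
theorem one_eq_oneHom : η[(curveAV omega omega_im_ne_zero).X] = eisPair.curve.oneHom := rfl

/-- **`rotOver` fixes the origin** (group-scheme form). [cite: SilvermanAEC2009, III.10.1] -/
theorem one_comp_rotOver :
    η[(curveAV omega omega_im_ne_zero).X] ≫ rotOver = η[(curveAV omega omega_im_ne_zero).X] :=
  oneHom_comp_rotOver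

/-- `rotOver` with source and target spelled as the scheme of the abelian variety `E_ω`
(definitionally the same morphism; the spelling carries the group-scheme instance). [folklore] -/
def rotOverX : (curveAV omega omega_im_ne_zero).X ⟶ (curveAV omega omega_im_ne_zero).X := rotOver

/-- `rotOverX` fixes the origin. [cite: SilvermanAEC2009, III.10.1] -/
theorem one_comp_rotOverX :
    η[(curveAV omega omega_im_ne_zero).X] ≫ rotOverX = η[(curveAV omega omega_im_ne_zero).X] :=
  oneHom_comp_rotOver

/-- `rotOverX` is a homomorphism of group schemes (rigidity: it fixes the origin; Mumford §4 Cor. 1,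
the tree's `isMonHom_of_one_comp`). [cite: MumfordAV1970, §4 Cor. 1] -/
instance isMonHom_rotOverX : IsMonHom rotOverX :=
  isMonHom_of_one_comp (A := curveAV omega omega_im_ne_zero) (B := curveAV omega omega_im_ne_zero)
    rotOverX one_comp_rotOverX

/-- **The automorphism `[ω] : E_ω → E_ω`, `(x, y) ↦ (ωx, y)`, as a homomorphism of abelian
varieties** (a morphism fixing `O` is a homomorphism: rigidity, Mumford §4 Cor. 1).
[cite: SilvermanAEC2009, III.10.1] [cite: MumfordAV1970, §4 Cor. 1] -/
def rot : curveAV omega omega_im_ne_zero ⟶ curveAV omega omega_im_ne_zero :=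
  InducedCategory.homMk (Grp.homMk rotOverX)

/-- The underlying morphism of `rot` is `rotOver` (`rfl`). [folklore] -/
theorem rot_hom : rot.hom.hom.hom = rotOver := rfl

/-- `[ω]` through the uniformisation: `u(z) ≫ [ω] = u(ωz)`. [cite: SilvermanAEC2009, VI.3] -/
theorem comp_rot_uE (z : ℂ) :
    uE omega omega_im_ne_zero z ≫ rot.hom.hom.hom = uE omega omega_im_ne_zero (omega * z) :=
  map_rotOver_upoint z

/-! ### `ρ = 2[ω] + 1 = [√-3]` and `ρ ∘ ρ = [-3]` -/

/-- **The complex multiplication `ρ = [ω] + [ω] + 1 = [2ω + 1] = [√-3]` of `E_ω`.**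
[cite: Cox2013, §10.C and Prop. 14.9] -/
def rho : curveAV omega omega_im_ne_zero ⟶ curveAV omega omega_im_ne_zero :=
  rot + rot + 𝟙 (curveAV omega omega_im_ne_zero)

/-- `ρ` through the uniformisation: `u(z) ≫ ρ = u((2ω + 1)z)` (homomorphisms act additively on
points, `evHom`, and `u` is a homomorphism, `uE_add`). [cite: Cox2013, Prop. 14.9] -/
theorem comp_rho_uE (z : ℂ) :
    uE omega omega_im_ne_zero z ≫ rho.hom.hom.hom = uE omega omega_im_ne_zero ((2 * omega + 1) * z) := by
  have h1 : evHom (uE omega omega_im_ne_zero z) rho =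
      evHom (uE omega omega_im_ne_zero z) rot + evHom (uE omega omega_im_ne_zero z) rot +
        evHom (uE omega omega_im_ne_zero z) (𝟙 (curveAV omega omega_im_ne_zero)) := by
    simp only [rho, map_add]
  have h2 := congrArg Additive.toMul h1
  simp only [evHom_apply, toMul_add, toMul_ofMul] at h2
  rw [h2, comp_rot_uE]
  change _ * (uE omega omega_im_ne_zero z ≫ 𝟙 _) = _
  rw [Category.comp_id, ← uE_add, ← uE_add]
  congr 1
  ring

/-- `u((2ω+1)((2ω+1)z)) = u(z)^{-3}` (`(2ω + 1)² = -3` and `u` is a homomorphism). [folklore] -/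
theorem uE_sqrtMinusThree_mul_sqrtMinusThree_mul (z : ℂ) :
    uE omega omega_im_ne_zero ((2 * omega + 1) * ((2 * omega + 1) * z)) =
      (uE omega omega_im_ne_zero z) ^ (-3 : ℤ) := by
  have hmul : (2 * omega + 1) * ((2 * omega + 1) * z) = (-3 : ℤ) • z := by
    rw [← mul_assoc, ← sq, two_mul_omega_add_one_sq]
    simp
  rw [hmul]
  have h := (uHom omega omega_im_ne_zero).map_zsmul (-3) z
  rw [uHom_apply, uHom_apply] at h
  exact congrArg Additive.toMul h

/-- The homomorphism `-(3 • 𝟙)` acts on points by `P ↦ P⁻³`. [folklore] -/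
theorem comp_neg_three_smul_id (P : ComplexPoints (curveAV omega omega_im_ne_zero).X) :
    P ≫ (-(((3 : ℕ) : ℤ) • 𝟙 (curveAV omega omega_im_ne_zero))).hom.hom.hom = P ^ (-3 : ℤ) := by
  have hneg : (-(((3 : ℕ) : ℤ) • 𝟙 (curveAV omega omega_im_ne_zero))) =
      (-3 : ℤ) • 𝟙 (curveAV omega omega_im_ne_zero) := by
    rw [neg_smul]
    rfl
  have h := (evHom (A := curveAV omega omega_im_ne_zero) P).map_zsmul (-3) (𝟙 (curveAV omega omega_im_ne_zero))
  have hid : P ≫ ((𝟙 (curveAV omega omega_im_ne_zero) :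
      curveAV omega omega_im_ne_zero ⟶ curveAV omega omega_im_ne_zero)).hom.hom.hom = P := Category.comp_id P
  rw [evHom_apply, evHom_apply, hid] at h
  have h' := congrArg Additive.toMul h
  simp only [toMul_ofMul, toMul_zsmul] at h'
  rw [hneg, h']

/-- **`ρ ∘ ρ = [-3]` on `E_ω`** (`(2ω + 1)² = -3`; checked on `ℂ`-points, through which every point
`u(z)` factors and which separate homomorphisms). [cite: Cox2013, §10.C and Prop. 14.9]
[cite: MumfordAV1970, §4] -/
theorem rho_comp_rho : rho ≫ rho = -(((3 : ℕ) : ℤ) • 𝟙 (curveAV omega omega_im_ne_zero)) := by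
  apply AbelianVariety.hom_ext
  haveI : IsReduced (curveAV omega omega_im_ne_zero).X.left := AbelianVariety.isReduced_left _
  refine SchemeOver.hom_ext_of_forall_algPoints ℂ fun P => ?_
  obtain ⟨z, rfl⟩ : ∃ z, uE omega omega_im_ne_zero z = P := PeriodPair.upoint_surjective _ P
  rw [comp_neg_three_smul_id]
  change (uE omega omega_im_ne_zero z ≫ rho.hom.hom.hom) ≫ rho.hom.hom.hom = _
  rw [comp_rho_uE, comp_rho_uE, uE_sqrtMinusThree_mul_sqrtMinusThree_mul]

/-- `ρ ∘ ρ = [-3]` with the natural-number scalar (the spelling `φ ≫ φ = -(d • 𝟙 A)` of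
`HodgeTheory/WeilClasses`, `AbelianVarietyEndomorphismsHOne`). [cite: Cox2013, §10.C and Prop. 14.9] -/
theorem rho_comp_rho_nsmul : rho ≫ rho = -((3 : ℕ) • 𝟙 (curveAV omega omega_im_ne_zero)) := by
  rw [rho_comp_rho, natCast_zsmul]

/-- `dim E_ω = 1`. [cite: SilvermanAEC2009, III.3.1(c)] -/
theorem dim_eisensteinCurve : (curveAV omega omega_im_ne_zero).dim = 1 := dim_curveAV _ _

end WeilSquare

end Literature.AlgebraicGeometry.HodgeTheory

end
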